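import Summits.Parity.GeneralizedHardyLittlewood.Theses.ParityWeightedChenSwitching
import Summits.Parity.GeneralizedHardyLittlewood.Theses.ParityLeakOneFifth
import Summits.Parity.GeneralizedHardyLittlewood.Theorems.LiouvilleShiftedTablesPairsHLStatus
import Summits.Parity.GeneralizedHardyLittlewood.Theorems.PairsToGHL.Negative.UnboundedSiegelZeros

/-!
# Crux `TwinLowerDensityToGHL` (stmt-Parity-18665), negative lane: the price of a disproof, the
# residual DOMINATES the registered residual `PairsToGHL`, and its Landau–Siegel cost

Refuter crux-attack at birth of the residual crux `R := TwinLowerDensityToGHL` of route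
`ParityWeightedChenSwitching` (Parity / GeneralizedHardyLittlewood), literally
`TwinLowerDensity → GeneralizedHardyLittlewood` with `TwinLowerDensity` (`T`) the route's own support
decl `∃ c > 0, ∃ x₀, ∀ x ≥ x₀, c·x/log²x ≤ π₂(x)`. Findings, all kernel-checked and sorry-free:

* §1 `not_twinLowerDensityToGHL_iff` — `¬R ↔ T ∧ ¬GHL`: an unconditional kill is simultaneously a
  proof of the twin prime conjecture in lower-density form and a refutation of Green–Tao's
  Conjecture 1.2; `R` is implied by the summit conjunct (`fun h _ => h`), so it is exactly as hard as
  the summit modulo `T`. The "shared node" of the sibling route `ParityLeakOneFifth`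
  (stmt-Parity-18377 / stmt-Parity-18380, typed with `twinPrimeCount`) is the SAME proposition by
  `Iff.rfl` (`parityLeakOneFifth_twinLowerDensityToGHL_iff`), although the two items were not merged.
* §2 DOMINATION. Hardy–Littlewood pairs at the single shift `h = 2` in `Λ`-form already give `T`
  with `c = 𝔖({0,2})/2 = C₂` (`twin_lower_bound_of_pairAsymptotic_two`, via the tree's
  `PairsHL.count_of_pairsHL_shift` / `eventually_count_bounds`); hence
  `¬PairsToGHL → ¬R` (`not_twinLowerDensityToGHL_of_not_pairsToGHL`): the new residual is AT LEAST AS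
  STRONG as the registered residual `LiouvilleShiftedTables.PairsToGHL` (stmt-Parity-9389, shared by
  LiouvilleShiftedTables / RoughSemiprimeRigidity / LiouvilleMAD / HullDial), and every negative
  finding of `Cruxes/PairsToGHL/Disproof.lean` and `Theorems/PairsToGHL/Negative/*` transfers to it.
* §3 LANDAU–SIEGEL COST. Modulo the vendored Matomäki–Merikoski Theorem 1.3, in the illusory world
  (`UnboundedSiegelZeros`) `R` is false as soon as `T` holds
  (`twinLowerDensityToGHL_false_of_unboundedSiegelZeros`), in particular as soon as the route's other
  three items deliver `T`; contrapositively `R ∧ T` bounds the quality of Siegel zeros at large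
  conductors (`siegelZeros_bounded_of_twinLowerDensityToGHL`) — any proof of `R` the route can use
  is a Landau–Siegel-type theorem, exactly as for `PairsToGHL`.
[folklore]
-/

namespace Summit.Parity.GeneralizedHardyLittlewood.Theorems.TwinLowerDensityToGHL.Negative

open Finset Filter Asymptotics
open Literature.NumberTheory.Sieve Literature.Barriers.Parity
open Summit.Parity.GeneralizedHardyLittlewood.Theses
open Summit.Parity.GeneralizedHardyLittlewood.Theses.ParityWeightedChenSwitching
  (TwinLowerDensity TwinLowerDensityToGHL)
open Summit.Parity.GeneralizedHardyLittlewood.Theses.LiouvilleShiftedTables (PairsHL PairsToGHL)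

noncomputable section

/-! ### §1 The price of a disproof; identity with the sibling route's node -/

/-- `¬R ↔ T ∧ ¬GHL`: refuting the residual means proving the twin prime conjecture in
lower-density form AND refuting Green–Tao's Conjecture 1.2. [folklore] -/
theorem not_twinLowerDensityToGHL_iff :
    ¬ TwinLowerDensityToGHL ↔ (TwinLowerDensity ∧ ¬ _root_.GeneralizedHardyLittlewood) :=
  Classical.not_imp

/-- In particular a refutation of `R` refutes the summit conjunct. [folklore] -/
theorem not_generalizedHardyLittlewood_of_not_twinLowerDensityToGHL (h : ¬ TwinLowerDensityToGHL) :
    ¬ _root_.GeneralizedHardyLittlewood :=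
  (not_twinLowerDensityToGHL_iff.mp h).2

/-- The sibling route's support node `ParityLeakOneFifth.TwinLowerDensity` (stmt-Parity-18377, typed
with `Literature.NumberTheory.Sieve.twinPrimeCount`) is the same proposition, by `rfl`. [folklore] -/
theorem parityLeakOneFifth_twinLowerDensity_iff :
    ParityLeakOneFifth.TwinLowerDensity ↔ TwinLowerDensity := Iff.rfl

/-- … and so is its residual `ParityLeakOneFifth.TwinLowerDensityToGHL` (stmt-Parity-18380): every
theorem of this file applies to it verbatim. [folklore] -/
theorem parityLeakOneFifth_twinLowerDensityToGHL_iff :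
    ParityLeakOneFifth.TwinLowerDensityToGHL ↔ TwinLowerDensityToGHL := Iff.rfl

/-! ### §2 Domination: `PairsHL` at `h = 2` gives `T`, so `¬PairsToGHL → ¬R` -/

/-- **Hardy–Littlewood pairs at the single shift `h = 2` give the twin lower density** with
`c = 𝔖({0,2})/2` (`= C₂`): from `∑_{n ≤ N} Λ(n)Λ(n+2) = 𝔖({0,2}) N + o(N)` the tree's
`PairsHL.count_of_pairsHL_shift` gives `π₂(x) ∼ 𝔖({0,2}) x/log²x`, whence eventually
`π₂(x) ≥ ½ 𝔖({0,2}) x/log²x`. (Conclusion = `TwinLowerDensity` unfolded.) [folklore] -/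
theorem twin_lower_bound_of_pairAsymptotic_two
    (hP : (fun N : ℕ => ∑ n ∈ Finset.Icc 1 N, ArithmeticFunction.vonMangoldt n *
        ArithmeticFunction.vonMangoldt (n + 2)
        - singularSeries ({0, ((2 : ℕ) : ℤ)} : Finset ℤ) * N) =o[atTop] fun N : ℕ => (N : ℝ)) :
    ∃ c : ℝ, 0 < c ∧ ∃ x₀ : ℕ, ∀ x : ℕ, x₀ ≤ x → c * (x : ℝ) / Real.log x ^ 2 ≤
      (((Finset.range (x + 1)).filter (fun p => p.Prime ∧ (p + 2).Prime)).card : ℝ) := by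
  have hS : 0 < singularSeries ({0, ((2 : ℕ) : ℤ)} : Finset ℤ) :=
    PairsHL.singularSeries_pair_pos_of_even (h := 2) (by decide) (by norm_num)
  have hc := PairsHL.count_of_pairsHL_shift hS hP
  obtain ⟨x₀, hx₀⟩ := eventually_atTop.mp (PairsHL.eventually_count_bounds hc one_half_pos)
  refine ⟨1 / 2 * singularSeries ({0, ((2 : ℕ) : ℤ)} : Finset ℤ), by positivity, x₀,
    fun x hx => ?_⟩
  have h := (hx₀ x hx).2
  have hset : ((Icc 1 x).filter fun n => n.Prime ∧ (n + 2).Prime)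
      = ((range (x + 1)).filter fun p => p.Prime ∧ (p + 2).Prime) := by
    ext n
    simp only [mem_filter, mem_Icc, mem_range, Nat.lt_succ_iff]
    constructor
    · rintro ⟨⟨-, hn⟩, hp⟩
      exact ⟨hn, hp⟩
    · rintro ⟨hn, hp⟩
      exact ⟨⟨hp.1.one_lt.le, hn⟩, hp⟩
  rw [hset] at h
  calc 1 / 2 * singularSeries ({0, ((2 : ℕ) : ℤ)} : Finset ℤ) * (x : ℝ) / Real.log x ^ 2
      = (1 - 1 / 2) * (singularSeries ({0, ((2 : ℕ) : ℤ)} : Finset ℤ) * x / Real.log x ^ 2) := by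
        ring
    _ ≤ _ := h

/-- **`R` fails whenever `PairsHL` holds and the summit conjunct fails**: `PairsHL → ¬GHL → ¬R`
(the `h = 2` instance of `PairsHL` supplies `T`). [folklore] -/
theorem not_twinLowerDensityToGHL_of_pairsHL (hP : PairsHL)
    (hG : ¬ _root_.GeneralizedHardyLittlewood) : ¬ TwinLowerDensityToGHL := fun hR =>
  hG (hR (twin_lower_bound_of_pairAsymptotic_two (hP 2 (by norm_num))))

/-- **Domination of the registered residual.** `¬PairsToGHL → ¬R`: any refutation of the shared
residual `PairsToGHL := PairsHL → GHL` (stmt-Parity-9389) refutes `R` as well; equivalently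
`R → PairsToGHL`. The converse would need `T → PairsHL` (a lower bound for one pattern giving the
asymptotic at every shift) and is not claimed. [folklore] -/
theorem not_twinLowerDensityToGHL_of_not_pairsToGHL (h : ¬ PairsToGHL) : ¬ TwinLowerDensityToGHL :=
  fun hR => h fun hP => hR (twin_lower_bound_of_pairAsymptotic_two (hP 2 (by norm_num)))

/-! ### §3 The Landau–Siegel cost: `R` in the illusory world -/

/-- **In the illusory world the residual fails as soon as the route delivers `T`.** Modulo the
vendored Matomäki–Merikoski Theorem 1.3: Siegel zeros of unbounded quality refute the typed
(shift-uniform) Green–Tao conjecture (tree: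
`PairsToGHL.Negative.not_generalizedHardyLittlewood_of_unboundedSiegelZeros`), so together with `T`
they refute `R`. [cite: MatomakiMerikoski2023, Theorem 1.3] -/
theorem twinLowerDensityToGHL_false_of_unboundedSiegelZeros
    (hMM : MatomakiMerikoski2023_pairCorrelation) (hU : UnboundedSiegelZeros)
    (hT : TwinLowerDensity) : ¬ TwinLowerDensityToGHL := fun hR =>
  PairsToGHL.Negative.not_generalizedHardyLittlewood_of_unboundedSiegelZeros hMM hU (hR hT)

/-- The same with `T` supplied by `PairsHL` (fixed-shift pairs are not obstructed by an exceptional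
zero). [cite: MatomakiMerikoski2023, Theorem 1.3] -/
theorem twinLowerDensityToGHL_false_of_unboundedSiegelZeros_of_pairsHL
    (hMM : MatomakiMerikoski2023_pairCorrelation) (hU : UnboundedSiegelZeros) (hP : PairsHL) :
    ¬ TwinLowerDensityToGHL :=
  not_twinLowerDensityToGHL_of_pairsHL hP
    (PairsToGHL.Negative.not_generalizedHardyLittlewood_of_unboundedSiegelZeros hMM hU)

/-- **Any proof of `R`, joined with the route's target `T`, bounds Siegel zeros**: modulo
Matomäki–Merikoski there are `η₀`, `q₀` such that no primitive quadratic character of conductor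
`q ≥ q₀` has a Siegel zero of quality `η ≥ η₀`. So the full output `K1 ∧ K2 ∧ S1 ∧ R` of route
`ParityWeightedChenSwitching` is (at least) a Landau–Siegel-type theorem, and the residual cannot be
discharged by anything consistent with `UnboundedSiegelZeros`. [cite: MatomakiMerikoski2023, Theorem 1.3] -/
theorem siegelZeros_bounded_of_twinLowerDensityToGHL (hMM : MatomakiMerikoski2023_pairCorrelation)
    (hR : TwinLowerDensityToGHL) (hT : TwinLowerDensity) :
    ∃ η₀ : ℝ, ∃ q₀ : ℕ, ∀ (q : ℕ) [NeZero q] (χ : DirichletCharacter ℂ q) (η : ℝ),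
      q₀ ≤ q → IsSiegelZero χ η → η < η₀ := by
  have hnot : ¬ UnboundedSiegelZeros := fun hU =>
    twinLowerDensityToGHL_false_of_unboundedSiegelZeros hMM hU hT hR
  unfold UnboundedSiegelZeros at hnot
  simp only [not_forall, not_exists, not_and] at hnot
  obtain ⟨η₀, q₀, hη⟩ := hnot
  refine ⟨η₀, q₀, fun q inst χ η hq hS => ?_⟩
  by_contra hlt
  exact hη q inst χ η hq (not_lt.mp hlt) hS

end

end Summit.Parity.GeneralizedHardyLittlewood.Theorems.TwinLowerDensityToGHL.Negative
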